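import Mathlib
import HarnessLib
import Literature.Analysis.FluidPDE.SelfSimilar
import Literature.Analysis.FluidPDE.NSBoundedMildOseen
import Literature.Analysis.FluidPDE.VorticityCalculus
import Summits.NavierStokesRegularity.NavierStokesRegularity.Theorems.PoloidalWindowDoorPoloidalWindowRigidityLargeScaleMomentum
import Summits.NavierStokesRegularity.NavierStokesRegularity.Theorems.PoloidalWindowDoorPoloidalWindowRigidityZeroMeanMomentum

/-!
# Route `PoloidalWindowDoor`, crux `PoloidalWindowRigidity` (stmt-NavierStokesRegularity-19708) — LINE 16 «zero_mode» v2.1 «zero_mode_bump» (ns-idea-8 g8): ZB, THE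
# ZERO-MODE LAW IN BUMP FORM — for a Type-I, continuous, Oseen-mild ancient profile, every admissible bump family `θ_R` and every direction `e`,
# `∫ θ_R ⟪v(t), e⟫ = o(R³)`

Cell ns-regularity-ideate, seat ns-poloidal-K2-p2 g13 (K2 hand; DIRECTOR-NS #276 key «zero_mode_bump», default (a)).  Port to Theorems level of §ZB of the sorry-free line
file `Cruxes/PoloidalWindowRigidity/Lines/zero_mode_bump.lean` v2.1 (ns-idea-8 g8), statements VERBATIM with the Cruxes-local `IsBumpFamily a θ` unfolded to its six clauses
(`∀ R ≥ 1`: test function, `tsupport θ_R ⊆ B̄(0,2R)`, `|θ_R| ≤ 1`, `‖Dθ_R‖ ≤ a/R`, `‖D²θ_R‖ ≤ a/R²`, `|Δθ_R| ≤ a/R²`); proof scripts verbatim (credit: ns-idea-8 g8).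

* `abs_defect_le`: the momentum defect of an admissible bump on a window `[s′, t]` is `≤ ‖e‖(t − s′)·K·R²` — ONE application of the tree's large-scale momentum
  lemma `…LargeScaleMomentum.abs_integral_mul_inner_sub_le` (nsreg-p7, the Oseen term included via `…DuhamelBump`) and the `L¹` sizes of `θ_R, Dθ_R, D²θ_R, Δθ_R`
  (`…ZeroMeanMomentum.integral_norm_le_of_le_of_support`);
* `zeroModeBumpLaw` (ZB): far past `s′` with `C‖e‖·8V₁/√(−s′) ≤ ε/2` (Type-I decay), then `R₀` with the defect `≤ ε/2·R³`.

This is the bump-family companion of the flat-box law `…ZeroModeNoHotPlane.zeroModeLaw` (Z, v1.1, this seat): same mechanism (the mild identity freezes the zero mode, Type-I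
decay in the past makes it vanish), every component / every centre, no Oseen box estimate.  WHAT THIS IS NOT: FB (the bump flux transport) and the second C1 kernel of v2.1
are not ported here (C1 is already a tree theorem, `…ZeroModeNoHotPlane.hotSplit_cellC1`); 19708 / 20428 OPEN; no claim about Navier–Stokes regularity.
-/

noncomputable section

-- the summit and its single sub-problem share the name (CONVENTIONS §1), as in every Theorems file
set_option linter.dupNamespace false

namespace Summit.NavierStokesRegularity.NavierStokesRegularity.Theorems.PoloidalWindowDoorPoloidalWindowRigidityZeroModeBumpLaw

open MeasureTheory Set Function Filter Topology Metric InnerProductSpace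
open scoped RealInnerProductSpace Laplacian
open Literature.Analysis Literature.Analysis.FluidPDE Literature.Analysis.UnboundedOperators
open Summit.NavierStokesRegularity.NavierStokesRegularity.Theorems.PoloidalWindowDoorPoloidalWindowRigidityLargeScaleMomentum
open Summit.NavierStokesRegularity.NavierStokesRegularity.Theorems.PoloidalWindowDoorPoloidalWindowRigidityZeroMeanMomentum

/-- A negative-time slice of a field continuous on the open past slab is continuous. [folklore] -/
theorem continuous_slice' {v : ℝ → (EuclideanSpace ℝ (Fin 3)) → (EuclideanSpace ℝ (Fin 3))}
    (hcont : ContinuousOn (uncurry v) (Iio (0 : ℝ) ×ˢ univ)) {t : ℝ} (ht : t < 0) : Continuous (v t) :=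
  hcont.comp_continuous (continuous_const.prodMk continuous_id) fun _ => ⟨ht, mem_univ _⟩

variable {C : ℝ} {v : ℝ → (EuclideanSpace ℝ (Fin 3)) → (EuclideanSpace ℝ (Fin 3))}

/-- **The momentum defect of an admissible bump on a window `[s', t]`** is `O((t − s')R²)` with a constant depending on the class bound at `t` only
(`IsBumpFamily` unfolded). [folklore] -/
theorem abs_defect_le (hrate : HasTypeITimeDecay C v)
    (hcont : ContinuousOn (uncurry v) (Iio (0 : ℝ) ×ˢ univ))
    (hmild : ∀ s t : ℝ, s < t → t < 0 → ∀ x, v t x = heatExtension (v s) (t - s) x - oseenDuhamel 1 s v v t x)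
    {t : ℝ} (ht : t < 0) {a : ℝ} (ha : 0 ≤ a) {θ : ℝ → (EuclideanSpace ℝ (Fin 3)) → ℝ}
    (hθ : (∀ R : ℝ, 1 ≤ R →
      FunctionSpaces.IsTestFunctionOn (⊤ : TopologicalSpace.Opens (EuclideanSpace ℝ (Fin 3))) (θ R) ∧
      tsupport (θ R) ⊆ closedBall (0 : (EuclideanSpace ℝ (Fin 3))) (2 * R) ∧
      (∀ x, |θ R x| ≤ 1) ∧
      (∀ x, ‖fderiv ℝ (θ R) x‖ ≤ a / R) ∧
      (∀ x, ‖fderiv ℝ (fderiv ℝ (θ R)) x‖ ≤ a / R ^ 2) ∧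
      (∀ x, |(Δ (θ R)) x| ≤ a / R ^ 2))) :
    ∃ K : ℝ, 0 ≤ K ∧ ∀ s' : ℝ, s' < t → ∀ R : ℝ, 1 ≤ R → ∀ e : (EuclideanSpace ℝ (Fin 3)),
      |∫ x, θ R x * ⟪v t x - v s' x, e⟫| ≤ ‖e‖ * (t - s') * (K * R ^ 2) := by
  -- the bound `M = C/√(−t)` on the whole past of `t`
  set M : ℝ := C / Real.sqrt (-t) with hM
  have hM0 : 0 ≤ M := (norm_nonneg _).trans (hrate t ht 0)
  have hC0 : 0 ≤ C := by
    by_contra hC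
    push Not at hC
    have h1 := div_neg_of_neg_of_pos hC (Real.sqrt_pos.2 (neg_pos.2 ht))
    linarith [(norm_nonneg (v t 0)).trans (hrate t ht 0)]
  have hMall : ∀ τ ≤ t, ∀ y, ‖v τ y‖ ≤ M := by
    intro τ hτ y
    have hτ0 : τ < 0 := lt_of_le_of_lt hτ ht
    refine (hrate τ hτ0 y).trans ?_
    exact div_le_div_of_nonneg_left hC0 (Real.sqrt_pos.2 (neg_pos.2 ht)) (Real.sqrt_le_sqrt (by linarith))
  -- the dimensional constants of the momentum lemma and the unit-ball volume
  set κ : ℝ := (2 : ℝ) ^ ((Module.finrank ℝ (EuclideanSpace ℝ (Fin 3)) : ℝ) / 2) with hκ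
  have hκ0 : 0 ≤ κ := by positivity
  set V₁ : ℝ := volume.real (closedBall (0 : (EuclideanSpace ℝ (Fin 3))) 1) with hV₁
  have hV₁0 : 0 ≤ V₁ := measureReal_nonneg
  refine ⟨(M * a + M ^ 2 * (a + κ * 2 * a + (3 / 2 * κ + 8 * 64 * κ ^ 3) * 2)) * (8 * V₁), by positivity,
    fun s' hs' R hR e => ?_⟩
  have hR0 : 0 < R := by linarith
  have hs'0 : s' < 0 := hs'.trans ht
  obtain ⟨hθt, hsupp, h0, h1, h2, hΔ⟩ := hθ R hR
  -- the volume of the supporting ball `B̄(0,2R)` is `8R³V₁`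
  set V2 : ℝ := volume.real (closedBall (0 : (EuclideanSpace ℝ (Fin 3))) (2 * R)) with hV2
  have hV2eq : V2 = 8 * R ^ 3 * V₁ := by
    rw [hV2, hV₁, Measure.addHaar_real_closedBall' volume (0 : (EuclideanSpace ℝ (Fin 3))) (by positivity : (0 : ℝ) ≤ 2 * R),
      finrank_euclideanSpace_fin]
    ring
  have hV20 : 0 ≤ V2 := measureReal_nonneg
  -- hypotheses of the momentum lemma on the window `(s', t)`
  have hsub : Ioo s' t ×ˢ (univ : Set (EuclideanSpace ℝ (Fin 3))) ⊆ Iio 0 ×ˢ univ :=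
    prod_mono (fun τ hτ => lt_trans hτ.2 ht) subset_rfl
  have hmeas : AEStronglyMeasurable (uncurry v) (volume.restrict (Ioo s' t ×ˢ univ)) :=
    (hcont.mono hsub).aestronglyMeasurable (measurableSet_Ioo.prod MeasurableSet.univ)
  have h := abs_integral_mul_inner_sub_le hs' hM0 hR0 hmeas (fun τ hτ y => hMall τ hτ.2.le y)
    (continuous_slice' hcont hs'0) (continuous_slice' hcont ht) (fun y => hMall s' hs'.le y) (fun y => hMall t le_rfl y)
    (hmild s' t hs' ht) hθt e
  -- the four `L¹` sizes (sup × volume of the support)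
  set ζ : (EuclideanSpace ℝ (Fin 3)) → ℝ := θ R with hζ
  have hout : ∀ x, x ∉ closedBall (0 : (EuclideanSpace ℝ (Fin 3))) (2 * R) → x ∉ tsupport ζ := fun x hx h' => hx (hsupp h')
  have hI0 : ∫ x, |ζ x| ≤ 1 * V2 := by
    have := integral_norm_le_of_le_of_support (f := ζ) (R := R) (A := 1)
      (fun x => by rw [Real.norm_eq_abs]; exact h0 x)
      (fun x hx => image_eq_zero_of_notMem_tsupport (hout x hx))
    simpa [Real.norm_eq_abs] using this
  have hI1 : ∫ x, ‖fderiv ℝ ζ x‖ ≤ a / R * V2 := by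
    refine integral_norm_le_of_le_of_support (F := (EuclideanSpace ℝ (Fin 3)) →L[ℝ] ℝ) (f := fderiv ℝ ζ)
      (fun x => ?_) (fun x hx => fderiv_of_notMem_tsupport ℝ (hout x hx))
    exact h1 x
  have hI2 : ∫ x, ‖fderiv ℝ (fderiv ℝ ζ) x‖ ≤ a / R ^ 2 * V2 := by
    refine integral_norm_le_of_le_of_support (F := (EuclideanSpace ℝ (Fin 3)) →L[ℝ] (EuclideanSpace ℝ (Fin 3) →L[ℝ] ℝ)) (f := fderiv ℝ (fderiv ℝ ζ))
      (fun x => ?_) (fun x hx => ?_)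
    · exact h2 x
    · have hx' : x ∉ tsupport (fderiv ℝ ζ) := fun h' => hout x hx (tsupport_fderiv_subset ℝ h')
      exact fderiv_of_notMem_tsupport ℝ hx'
  have hIΔ : ∫ x, ‖(Δ ζ) x‖ ≤ a / R ^ 2 * V2 := by
    refine integral_norm_le_of_le_of_support (fun x => ?_) (fun x hx => ?_)
    · rw [Real.norm_eq_abs]; exact hΔ x
    · exact FluidPDE.laplacian_eq_zero_of_notMem_tsupport (hout x hx)
  -- collect: every size is `≤ (const) · V2 / R` since `R ≥ 1`
  have hR1 : 1 / R ^ 2 ≤ 1 / R := by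
    rw [div_le_div_iff₀ (by positivity) hR0]; nlinarith
  have e1 : M * (∫ x, ‖(Δ ζ) x‖) ≤ M * a * (V2 / R) := by
    have : a / R ^ 2 * V2 ≤ a * (V2 / R) := by
      have := mul_le_mul_of_nonneg_left hR1 (mul_nonneg ha hV20)
      calc a / R ^ 2 * V2 = a * V2 * (1 / R ^ 2) := by ring
        _ ≤ a * V2 * (1 / R) := this
        _ = a * (V2 / R) := by ring
    nlinarith [mul_le_mul_of_nonneg_left (hIΔ.trans this) hM0]
  have e2 : (∫ x, ‖fderiv ℝ ζ x‖) ≤ a * (V2 / R) := by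
    calc (∫ x, ‖fderiv ℝ ζ x‖) ≤ a / R * V2 := hI1
      _ = a * (V2 / R) := by ring
  have e3 : κ * (2 * R) * (∫ x, ‖fderiv ℝ (fderiv ℝ ζ) x‖) ≤ κ * 2 * a * (V2 / R) := by
    have h3 := mul_le_mul_of_nonneg_left hI2 (by positivity : 0 ≤ κ * (2 * R))
    calc κ * (2 * R) * (∫ x, ‖fderiv ℝ (fderiv ℝ ζ) x‖) ≤ κ * (2 * R) * (a / R ^ 2 * V2) := h3
      _ = κ * 2 * a * (V2 / R) := by field_simp
  have e4 : (3 / 2 * κ + 8 * 64 * κ ^ 3) * (2 / R) * (∫ x, |ζ x|) ≤ (3 / 2 * κ + 8 * 64 * κ ^ 3) * 2 * (V2 / R) := by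
    have h4 := mul_le_mul_of_nonneg_left hI0 (by positivity : 0 ≤ (3 / 2 * κ + 8 * 64 * κ ^ 3) * (2 / R))
    calc (3 / 2 * κ + 8 * 64 * κ ^ 3) * (2 / R) * (∫ x, |ζ x|)
        ≤ (3 / 2 * κ + 8 * 64 * κ ^ 3) * (2 / R) * (1 * V2) := h4
      _ = (3 / 2 * κ + 8 * 64 * κ ^ 3) * 2 * (V2 / R) := by field_simp
  refine h.trans ?_
  have hes : 0 ≤ ‖e‖ * (t - s') := mul_nonneg (norm_nonneg _) (by linarith)
  have hsum : M * (∫ x, ‖(Δ ζ) x‖) + M ^ 2 * ((∫ x, ‖fderiv ℝ ζ x‖) +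
      κ * (2 * R) * (∫ x, ‖fderiv ℝ (fderiv ℝ ζ) x‖) + (3 / 2 * κ + 8 * 64 * κ ^ 3) * (2 / R) * (∫ x, |ζ x|)) ≤
      (M * a + M ^ 2 * (a + κ * 2 * a + (3 / 2 * κ + 8 * 64 * κ ^ 3) * 2)) * V2 / R := by
    have hM2 : 0 ≤ M ^ 2 := sq_nonneg _
    have := add_le_add e1 (mul_le_mul_of_nonneg_left (add_le_add (add_le_add e2 e3) e4) hM2)
    refine this.trans (le_of_eq ?_)
    ring
  have hfin : (M * a + M ^ 2 * (a + κ * 2 * a + (3 / 2 * κ + 8 * 64 * κ ^ 3) * 2)) * V2 / R =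
      (M * a + M ^ 2 * (a + κ * 2 * a + (3 / 2 * κ + 8 * 64 * κ ^ 3) * 2)) * (8 * V₁) * R ^ 2 := by
    rw [hV2eq]; field_simp
  calc ‖e‖ * (t - s') * (M * (∫ x, ‖(Δ ζ) x‖) + M ^ 2 * ((∫ x, ‖fderiv ℝ ζ x‖) +
        κ * (2 * R) * (∫ x, ‖fderiv ℝ (fderiv ℝ ζ) x‖) + (3 / 2 * κ + 8 * 64 * κ ^ 3) * (2 / R) * (∫ x, |ζ x|)))
      ≤ ‖e‖ * (t - s') * ((M * a + M ^ 2 * (a + κ * 2 * a + (3 / 2 * κ + 8 * 64 * κ ^ 3) * 2)) * V2 / R) :=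
        mul_le_mul_of_nonneg_left hsum hes
    _ = ‖e‖ * (t - s') * ((M * a + M ^ 2 * (a + κ * 2 * a + (3 / 2 * κ + 8 * 64 * κ ^ 3) * 2)) * (8 * V₁) * R ^ 2) := by
        rw [hfin]

/-- **ZB — zero-mode law, bump form** (`ZeroModeBump.ZeroModeBumpLaw` VERBATIM, `IsBumpFamily` unfolded): for a profile of the route's Type-I class, every `t < 0`,
every admissible bump family and every direction `e`, `∫ θ_R ⟪v(t), e⟫ = o(R³)` (`abs_defect_le` + the Type-I bound `C/√(−s')` in the far past). -/
theorem zeroModeBumpLaw :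
    ∀ (C : ℝ) (v : ℝ → (EuclideanSpace ℝ (Fin 3)) → (EuclideanSpace ℝ (Fin 3))),
    HasTypeITimeDecay C v →
    ContinuousOn (uncurry v) (Iio (0 : ℝ) ×ˢ univ) →
    (∀ s t : ℝ, s < t → t < 0 → ∀ x, v t x = heatExtension (v s) (t - s) x - oseenDuhamel 1 s v v t x) →
    ∀ t : ℝ, t < 0 → ∀ (a : ℝ) (θ : ℝ → (EuclideanSpace ℝ (Fin 3)) → ℝ), 0 ≤ a →
      (∀ R : ℝ, 1 ≤ R →
      FunctionSpaces.IsTestFunctionOn (⊤ : TopologicalSpace.Opens (EuclideanSpace ℝ (Fin 3))) (θ R) ∧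
      tsupport (θ R) ⊆ closedBall (0 : (EuclideanSpace ℝ (Fin 3))) (2 * R) ∧
      (∀ x, |θ R x| ≤ 1) ∧
      (∀ x, ‖fderiv ℝ (θ R) x‖ ≤ a / R) ∧
      (∀ x, ‖fderiv ℝ (fderiv ℝ (θ R)) x‖ ≤ a / R ^ 2) ∧
      (∀ x, |(Δ (θ R)) x| ≤ a / R ^ 2)) →
      ∀ (e : (EuclideanSpace ℝ (Fin 3))) (ε : ℝ), 0 < ε → ∃ R₀ : ℝ, 1 ≤ R₀ ∧ ∀ R : ℝ, R₀ ≤ R → |∫ x, θ R x * ⟪v t x, e⟫| ≤ ε * R ^ 3 := by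
  intro C v hrate hcont hmild t ht a θ ha hθ e ε hε
  obtain ⟨K, hK0, hK⟩ := abs_defect_le hrate hcont hmild ht ha hθ
  have hC0 : 0 ≤ C := by
    by_contra hC
    push Not at hC
    have h1 := div_neg_of_neg_of_pos hC (Real.sqrt_pos.2 (neg_pos.2 ht))
    linarith [(norm_nonneg (v t 0)).trans (hrate t ht 0)]
  set V₁ : ℝ := volume.real (closedBall (0 : (EuclideanSpace ℝ (Fin 3))) 1) with hV₁
  have hV₁0 : 0 ≤ V₁ := measureReal_nonneg
  -- ## the far-past time `s'`: `C‖e‖·8V₁/√(−s') ≤ ε/2`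
  set A : ℝ := 2 * C * ‖e‖ * (8 * V₁) / ε with hA
  have hA0 : 0 ≤ A := by positivity
  set s' : ℝ := min (t - 1) (-(A ^ 2 + 1)) with hs'def
  have hs't : s' < t := lt_of_le_of_lt (min_le_left _ _) (by linarith)
  have hs'0 : s' < 0 := hs't.trans ht
  have hs'le : s' ≤ -(A ^ 2 + 1) := min_le_right _ _
  have hsq : A ≤ Real.sqrt (-s') := by
    have h1 : A ^ 2 ≤ -s' := by linarith
    calc A = Real.sqrt (A ^ 2) := (Real.sqrt_sq hA0).symm
      _ ≤ Real.sqrt (-s') := Real.sqrt_le_sqrt h1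
  have hsq0 : 0 < Real.sqrt (-s') := Real.sqrt_pos.2 (neg_pos.2 hs'0)
  have hfar : C / Real.sqrt (-s') * ‖e‖ * (8 * V₁) ≤ ε / 2 := by
    have h1 : C * ‖e‖ * (8 * V₁) = ε / 2 * A := by rw [hA]; field_simp
    have h2 : ε / 2 * A ≤ ε / 2 * Real.sqrt (-s') := mul_le_mul_of_nonneg_left hsq (by positivity)
    rw [div_mul_eq_mul_div, div_mul_eq_mul_div, div_le_iff₀ hsq0, h1]
    linarith
  -- ## the radius
  set R₀ : ℝ := max 1 (2 * ‖e‖ * (t - s') * K / ε) with hR₀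
  refine ⟨R₀, le_max_left _ _, fun R hR => ?_⟩
  have hR1 : 1 ≤ R := le_trans (le_max_left _ _) hR
  have hR0 : 0 < R := by linarith
  have hRK : ‖e‖ * (t - s') * (K * R ^ 2) ≤ ε / 2 * R ^ 3 := by
    have h1 : 2 * ‖e‖ * (t - s') * K / ε ≤ R := le_trans (le_max_right _ _) hR
    rw [div_le_iff₀ hε] at h1
    have h2 : 0 ≤ R ^ 2 := sq_nonneg _
    nlinarith [mul_le_mul_of_nonneg_right h1 h2]
  obtain ⟨hθt, hsupp, h0, -, -, -⟩ := hθ R hR1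
  -- ## continuity / integrability
  have hζc : Continuous (θ R) := hθt.contDiff.continuous
  have hζcs : HasCompactSupport (θ R) := hθt.hasCompactSupport
  have hvt : Continuous (v t) := continuous_slice' hcont ht
  have hvs : Continuous (v s') := continuous_slice' hcont hs'0
  have hint1 : Integrable (fun x => θ R x * ⟪v t x - v s' x, e⟫) :=
    (hζc.mul ((hvt.sub hvs).inner continuous_const)).integrable_of_hasCompactSupport hζcs.mul_right
  have hint2 : Integrable (fun x => θ R x * ⟪v s' x, e⟫) :=
    (hζc.mul (hvs.inner continuous_const)).integrable_of_hasCompactSupport hζcs.mul_right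
  have hsplit : ∫ x, θ R x * ⟪v t x, e⟫ = (∫ x, θ R x * ⟪v t x - v s' x, e⟫) + ∫ x, θ R x * ⟪v s' x, e⟫ := by
    rw [← integral_add hint1 hint2]
    congr 1; ext x
    rw [inner_sub_left]; ring
  -- ## the far-past term
  have hout : ∀ x, x ∉ closedBall (0 : (EuclideanSpace ℝ (Fin 3))) (2 * R) → x ∉ tsupport (θ R) := fun x hx h' => hx (hsupp h')
  have hMs' : ∀ y, ‖v s' y‖ ≤ C / Real.sqrt (-s') := fun y => hrate s' hs'0 y
  have hfarR : |∫ x, θ R x * ⟪v s' x, e⟫| ≤ C / Real.sqrt (-s') * ‖e‖ * (8 * V₁) * R ^ 3 := by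
    have hle : ∀ x, ‖θ R x * ⟪v s' x, e⟫‖ ≤ C / Real.sqrt (-s') * ‖e‖ := by
      intro x
      rw [norm_mul, Real.norm_eq_abs]
      have h1 : ‖⟪v s' x, e⟫‖ ≤ ‖v s' x‖ * ‖e‖ := norm_inner_le_norm _ _
      have h2 : ‖v s' x‖ * ‖e‖ ≤ C / Real.sqrt (-s') * ‖e‖ := mul_le_mul_of_nonneg_right (hMs' x) (norm_nonneg _)
      calc |θ R x| * ‖⟪v s' x, e⟫‖ ≤ 1 * (C / Real.sqrt (-s') * ‖e‖) :=
            mul_le_mul (h0 x) (h1.trans h2) (norm_nonneg _) zero_le_one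
        _ = C / Real.sqrt (-s') * ‖e‖ := one_mul _
    have hI := integral_norm_le_of_le_of_support (f := fun x => θ R x * ⟪v s' x, e⟫) (R := R)
      (A := C / Real.sqrt (-s') * ‖e‖) hle
      (fun x hx => by rw [image_eq_zero_of_notMem_tsupport (hout x hx), zero_mul])
    have hV2eq : volume.real (closedBall (0 : (EuclideanSpace ℝ (Fin 3))) (2 * R)) = 8 * R ^ 3 * V₁ := by
      rw [hV₁, Measure.addHaar_real_closedBall' volume (0 : (EuclideanSpace ℝ (Fin 3))) (by positivity : (0 : ℝ) ≤ 2 * R),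
        finrank_euclideanSpace_fin]
      ring
    calc |∫ x, θ R x * ⟪v s' x, e⟫| = ‖∫ x, θ R x * ⟪v s' x, e⟫‖ := (Real.norm_eq_abs _).symm
      _ ≤ ∫ x, ‖θ R x * ⟪v s' x, e⟫‖ := norm_integral_le_integral_norm _
      _ ≤ C / Real.sqrt (-s') * ‖e‖ * volume.real (closedBall (0 : (EuclideanSpace ℝ (Fin 3))) (2 * R)) := hI
      _ = C / Real.sqrt (-s') * ‖e‖ * (8 * V₁) * R ^ 3 := by rw [hV2eq]; ring
  -- ## assemble
  have hdef := hK s' hs't R hR1 e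
  have hR3 : 0 ≤ R ^ 3 := by positivity
  calc |∫ x, θ R x * ⟪v t x, e⟫|
      = |(∫ x, θ R x * ⟪v t x - v s' x, e⟫) + ∫ x, θ R x * ⟪v s' x, e⟫| := by rw [hsplit]
    _ ≤ |∫ x, θ R x * ⟪v t x - v s' x, e⟫| + |∫ x, θ R x * ⟪v s' x, e⟫| := abs_add_le _ _
    _ ≤ ε / 2 * R ^ 3 + C / Real.sqrt (-s') * ‖e‖ * (8 * V₁) * R ^ 3 := add_le_add (hdef.trans hRK) hfarR
    _ ≤ ε / 2 * R ^ 3 + ε / 2 * R ^ 3 := by gcongr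
    _ = ε * R ^ 3 := by ring

end Summit.NavierStokesRegularity.NavierStokesRegularity.Theorems.PoloidalWindowDoorPoloidalWindowRigidityZeroModeBumpLaw

end
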